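import Literature.Analysis.FluidPDE.TaoClassGlue
import Literature.Analysis.FluidPDE.H1ContinuationSobolevClass
import Literature.Analysis.FluidPDE.TaoLocalisation
import Literature.Analysis.FluidPDE.TaoLocalisationContinuation
import HarnessLib

/-!
# Route `GaldiLiouvilleGate`, crux `RecordZoomAncient` (stmt-NavierStokesRegularity-0894),
  line `registered` (birth skeleton, reshape r4) — stub `stub_enstrophyConcentrationBranch`
  (enstrophy concentration at the critical scale forces velocity concentration)

**Statement.** Write `E(s) = ∫⁻ |∇u(s)|²` for a classical solution `u` of the unforced
Navier–Stokes system on `ℝ³ × [0, T)` which is Leray–Hopf, Tao-class on every `[0, T']`,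
`T' < T`, and admits no smooth extension past `T`. Inputs: the persistence bound of the
enstrophy (`E(t₀) ≤ L ⇒ E(t) ≤ K_P L` for `t ∈ [t₀, T)`, `t − t₀ ≤ c_P ν³/L²`), the uniform
`C^{1,κ}` bound (after three critical time units an enstrophy-dominated solution has
`|∇u| ≤ C₁ L²/ν³` and `|∇u(x) − ∇u(x')| ≤ H (L²/ν³) (L‖x − x'‖/ν²)^κ`), radii/fractions `R, ε > 0`,
and ENSTROPHY CONCENTRATION arbitrarily close to `T`: a time `t`, a level `L > 0` dominating `E`
on `[0, t]` with `t ≥ 3ν³/L²`, and a ball of radius `R ν²/L` carrying enstrophy `≥ ε L`.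
Output: base times `tc n ∈ (0, T)`, centres `xc n`, levels `L n > 0` dominating `E` on
`[0, tc n]`, a rescaled time `s₀ < 0` and a `θ > 0` with `tc n · (L n)² → ∞` and
`θ ≤ ‖(ν / L n) • u (tc n + ν³ s₀/(L n)²) (xc n)‖`.

**Proof.** (a) `E` is unbounded on `[0, T)` (no smooth extension + `H¹` continuation,
`exists_enstrophy_gt`). (b) ROOM: `E ≤ L'` on `[0, t]` forces `T − t > c_P ν³/L'²` (persistence).
(c) `E` is bounded on `[0, T/2]` (Sobolev bound of the Tao representation). (d) Probing at times
`t*ₙ > T/2` with `E(t*ₙ) > n`, concentration gives `t ≥ t*ₙ`, a centre `x` and a level `L > n`.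
(e) POINTWISE STEP (`exists_velocity_const`): if a ball of radius `R ν²/L` carries `≥ ε L` of
`∫ |∇g|²`, some point `y₁` has `|∇g(y₁)|² ≥ ε L/(2 vol)` (`exists_lt_of_le_setLIntegral_ball`),
hence `‖∇g(y₁)‖ > (L²/ν³) q₀`, `q₀ = √(ε/(6 R³ |B₁|))`; along a segment of length
`h = h₀ ν²/L`, `h₀ = min 1 ((q₀/(4(|H|+1)))^{1/κ})`, in a direction nearly attaining the operator
norm, the mean value inequality with the Hölder bound of `∇g` gives
`‖g(y₁ + h e) − g(y₁)‖ > h ((L²/ν³) q₀ − (L²/ν³) q₀/4)` (`exists_norm_gt_of_fderiv`), so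
`‖g‖ > (3 h₀ q₀/8) L/ν` at `y₁` or at `y₁ + h e`. (f) Witnesses: `L n = K_P L`, `xc n` that point,
`tc n = t + c_P ν³/(2L²)` (inside the room of (b); `E ≤ L n` on `[0, tc n]` by domination on
`[0, t]` and persistence from `t`), `s₀ = −c_P K_P²/2` (so that the rescaled time `s₀` of the zoom
based at `tc n` is the original time `t`), `θ = (3 h₀ q₀/8)/K_P`; finally `tc n > T/2` and
`L n > n` give `tc n (L n)² ≥ (T/2) n² → ∞`.
-/

noncomputable section

open Set MeasureTheory Filter Topology Function Metric
open scoped ENNReal NNReal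
open Literature.Analysis.FluidPDE

namespace Summit.NavierStokesRegularity.NavierStokesRegularity.Theorems.RecordZoomAncient.Birth

-- the problem-side namespace `Summit.NavierStokesRegularity.NavierStokesRegularity.…` (summit =
-- problem for this single-problem summit) duplicates `NavierStokesRegularity` by design
set_option linter.dupNamespace false

/-- **(a) The enstrophy is unbounded before a blow-up time.** For a classical solution on
`[0, T)` which is Leray–Hopf, Tao-class on every `[0, T']`, `T' < T`, and has no smooth
extension past `T`, the enstrophy `E(t) = ∫⁻ |∇u(t)|²` exceeds every finite level somewhere on
`[0, T)`: otherwise `‖u(t)‖²_{L²} + ‖∇u(t)‖²_{L²}` is bounded on `[0, T)` (energy inequality) and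
`hasSobolevExtensionPast_of_uniform_H1_bound` continues `u` past `T`. -/
private theorem exists_enstrophy_gt {ν T : ℝ} (hν : 0 < ν) (hT : 0 < T)
    {u : ℝ → EuclideanSpace ℝ (Fin 3) → EuclideanSpace ℝ (Fin 3)}
    {p : ℝ → EuclideanSpace ℝ (Fin 3) → ℝ}
    (hsol : IsClassicalNSSolutionOn (Ico 0 T) ν 0 u p) (hLH : IsLerayHopfOn T ν 0 (u 0) u)
    (hrep : ∀ T' ∈ Ioo 0 T, ∃ P : ℝ → EuclideanSpace ℝ (Fin 3) → ℝ,
      IsTaoSolutionOn T' ν (u 0) u P)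
    (hnext : ¬ HasSmoothExtensionPast ν 0 u T) {E : ℝ → ℝ≥0∞}
    (hE : ∀ s, E s = ∫⁻ x, ENNReal.ofReal (frobeniusNormSq (fderiv ℝ (u s) x))) {M : ℝ≥0∞}
    (hM : M < ⊤) : ∃ t ∈ Ico 0 T, M < E t := by
  by_contra h
  push Not at h
  -- the Sobolev class on every `[0, T'']`, `T'' < T`, from the representation
  have hreg : ∀ T'' < T, HasBoundedSobolevNormsOn (Icc 0 T'') u := fun T'' hT'' => by
    obtain ⟨P, hP⟩ := hrep (max T'' (T / 2))
      ⟨(half_pos hT).trans_le (le_max_right _ _), max_lt hT'' (half_lt_self hT)⟩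
    exact hP.sobolev.mono (Icc_subset_Icc_right (le_max_left _ _))
  have hKE : 0 ≤ VectorCalculus.kineticEnergy (u 0) := kineticEnergy_nonneg _
  have h2KE : 0 ≤ 2 * VectorCalculus.kineticEnergy (u 0) := by positivity
  have hA0 : 0 ≤ 2 * VectorCalculus.kineticEnergy (u 0) + M.toReal :=
    add_nonneg h2KE ENNReal.toReal_nonneg
  refine hnext (hasSobolevExtensionPast_of_uniform_H1_bound hν hT hsol hreg hA0
    fun t ht => ?_).hasSmoothExtensionPast
  rw [ENNReal.ofReal_add h2KE ENNReal.toReal_nonneg, ENNReal.ofReal_toReal hM.ne, ← hE t]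
  exact add_le_add (hLH.lintegral_enorm_sq_le hν.le (Ico_subset_Icc_self ht)) (h t ht)

/-- **(e-i) Concentration gives a point of large density.** If a ball of radius `ρ` in `ℝ³`
carries `∫⁻_{B} F ≥ c > 0`, then `F > c/(2 ρ³ |B₁|)` somewhere (`|B₁|` the volume of the unit
ball): otherwise `∫⁻_B F ≤ (c/(2ρ³|B₁|)) · ρ³ |B₁| = c/2 < c`. -/
private theorem exists_lt_of_le_setLIntegral_ball {F : EuclideanSpace ℝ (Fin 3) → ℝ}
    {x : EuclideanSpace ℝ (Fin 3)} {ρ c : ℝ} (hρ : 0 < ρ) (hc : 0 < c)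
    (hconc : ENNReal.ofReal c ≤ ∫⁻ y in ball x ρ, ENNReal.ofReal (F y)) :
    ∃ y, c / (2 * (ρ ^ 3 * (volume (ball (0 : EuclideanSpace ℝ (Fin 3)) 1)).toReal)) < F y := by
  set V₁ := (volume (ball (0 : EuclideanSpace ℝ (Fin 3)) 1)).toReal with hV₁
  have hV₁0 : 0 < V₁ :=
    ENNReal.toReal_pos (measure_ball_pos volume _ one_pos).ne' measure_ball_lt_top.ne
  by_contra h
  push Not at h
  have hvol : volume (ball x ρ) = ENNReal.ofReal (ρ ^ 3 * V₁) := by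
    rw [Measure.addHaar_ball_of_pos volume x hρ, finrank_euclideanSpace_fin,
      ENNReal.ofReal_mul (by positivity), hV₁, ENNReal.ofReal_toReal measure_ball_lt_top.ne]
  have hle : ∫⁻ y in ball x ρ, ENNReal.ofReal (F y) ≤ ENNReal.ofReal (c / 2) :=
    calc ∫⁻ y in ball x ρ, ENNReal.ofReal (F y)
        ≤ ∫⁻ _ in ball x ρ, ENNReal.ofReal (c / (2 * (ρ ^ 3 * V₁))) :=
          setLIntegral_mono measurable_const fun y _ => ENNReal.ofReal_le_ofReal (h y)
      _ = ENNReal.ofReal (c / (2 * (ρ ^ 3 * V₁))) * ENNReal.ofReal (ρ ^ 3 * V₁) := by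
          rw [setLIntegral_const, hvol]
      _ = ENNReal.ofReal (c / 2) := by
          rw [← ENNReal.ofReal_mul (by positivity)]
          congr 1
          field_simp
  have hlt : ENNReal.ofReal (c / 2) < ENNReal.ofReal c :=
    (ENNReal.ofReal_lt_ofReal_iff hc).2 (by linarith)
  exact absurd (hconc.trans hle) (not_le.2 hlt)

/-- **(e-ii/iii) The segment argument.** If `‖∇g(y₁)‖ > q` and `‖∇g − ∇g(y₁)‖ ≤ M` on the closed
ball of radius `h > 0` about `y₁`, then `‖g‖ > h (q − M)/2` somewhere: pick `e`, `‖e‖ < 1`, with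
`‖∇g(y₁) e‖ > q`; the mean value inequality gives `‖g(y₁ + h e) − g(y₁) − h ∇g(y₁) e‖ ≤ M h`, so
`‖g(y₁ + h e)‖ + ‖g(y₁)‖ ≥ ‖g(y₁ + h e) − g(y₁)‖ > h q − M h`. -/
private theorem exists_norm_gt_of_fderiv
    {g : EuclideanSpace ℝ (Fin 3) → EuclideanSpace ℝ (Fin 3)} (hg : Differentiable ℝ g)
    {y₁ : EuclideanSpace ℝ (Fin 3)} {q M h : ℝ} (hh : 0 < h) (hq : q < ‖fderiv ℝ g y₁‖)
    (hM : ∀ y ∈ closedBall y₁ h, ‖fderiv ℝ g y - fderiv ℝ g y₁‖ ≤ M) :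
    ∃ y₂, h * (q - M) / 2 < ‖g y₂‖ := by
  obtain ⟨e, he, hqe⟩ := (fderiv ℝ g y₁).exists_lt_apply_of_lt_opNorm hq
  have hM0 : 0 ≤ M := le_trans (by simp) (hM y₁ (mem_closedBall_self hh.le))
  set y := y₁ + h • e with hy
  have hyy₁ : y - y₁ = h • e := by rw [hy, add_sub_cancel_left]
  have hhe : ‖h • e‖ ≤ h := by
    rw [norm_smul, Real.norm_of_nonneg hh.le]
    exact mul_le_of_le_one_right hh.le he.le
  have hymem : y ∈ closedBall y₁ h := mem_closedBall_iff_norm.2 (hyy₁ ▸ hhe)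
  have hmvt := (convex_closedBall y₁ h).norm_image_sub_le_of_norm_fderiv_le' (fun z _ => hg z) hM
    (mem_closedBall_self hh.le) hymem
  rw [hyy₁, ContinuousLinearMap.map_smul] at hmvt
  -- `hmvt : ‖g y - g y₁ - h • ∇g(y₁) e‖ ≤ M * ‖h • e‖`
  have hd : ‖g y - g y₁ - h • fderiv ℝ g y₁ e‖ ≤ M * h :=
    hmvt.trans (mul_le_mul_of_nonneg_left hhe hM0)
  have h1 : ‖h • fderiv ℝ g y₁ e‖ ≤ ‖g y - g y₁‖ + ‖g y - g y₁ - h • fderiv ℝ g y₁ e‖ :=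
    calc ‖h • fderiv ℝ g y₁ e‖ = ‖(g y - g y₁) - (g y - g y₁ - h • fderiv ℝ g y₁ e)‖ := by
          rw [sub_sub_cancel]
      _ ≤ _ := norm_sub_le _ _
  have h2 : ‖h • fderiv ℝ g y₁ e‖ = h * ‖fderiv ℝ g y₁ e‖ := by
    rw [norm_smul, Real.norm_of_nonneg hh.le]
  have h3 : ‖g y - g y₁‖ ≤ ‖g y‖ + ‖g y₁‖ := norm_sub_le _ _
  by_contra hcon
  push Not at hcon
  have h4 := hcon y
  have h5 := hcon y₁
  nlinarith [mul_lt_mul_of_pos_left hqe hh]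

/-- **(e) The pointwise step: enstrophy concentration at the critical scale forces a velocity of
the critical size.** There is `θ₀ = θ₀(R, ε, H, κ) > 0` such that for every differentiable
`g : ℝ³ → ℝ³`, level `L > 0` and viscosity `ν > 0` with the Hölder bound
`‖∇g(y) − ∇g(y')‖ ≤ H (L²/ν³) (L‖y − y'‖/ν²)^κ` and a ball of radius `R ν²/L` carrying
`∫ |∇g|² ≥ ε L`, some point has `‖g‖ ≥ θ₀ L/ν`. With `|B₁|` the volume of the unit ball,
`q₀ = √(ε/(6 R³ |B₁|))`, `h₀ = min 1 ((q₀/(4(|H|+1)))^{1/κ})`, `θ₀ = 3 h₀ q₀/8`: a point `y₁` with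
`|∇g(y₁)|² > ε L/(2 (Rν²/L)³ |B₁|)` (`exists_lt_of_le_setLIntegral_ball`) has
`‖∇g(y₁)‖ > (L²/ν³) q₀` (`|A|² ≤ 3‖A‖²`); on the ball of radius `h₀ ν²/L` about `y₁` the Hölder
bound gives `‖∇g − ∇g(y₁)‖ ≤ |H| (L²/ν³) h₀^κ ≤ (L²/ν³) q₀/4`, and `exists_norm_gt_of_fderiv`
gives `‖g‖ > (h₀ν²/L) (L²/ν³) (3q₀/4)/2 = θ₀ L/ν` somewhere. -/
private theorem exists_velocity_const (H : ℝ) {R ε κ : ℝ} (hR : 0 < R) (hε : 0 < ε)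
    (hκ : 0 < κ) :
    ∃ θ₀ : ℝ, 0 < θ₀ ∧
      ∀ (g : EuclideanSpace ℝ (Fin 3) → EuclideanSpace ℝ (Fin 3)) (L ν : ℝ)
        (x : EuclideanSpace ℝ (Fin 3)), 0 < L → 0 < ν → Differentiable ℝ g →
        (∀ y y', ‖fderiv ℝ g y - fderiv ℝ g y'‖ ≤
          H * (L ^ 2 / ν ^ 3) * (L / ν ^ 2 * ‖y - y'‖) ^ κ) →
        ENNReal.ofReal (ε * L) ≤
          ∫⁻ y in ball x (R * ν ^ 2 / L), ENNReal.ofReal (frobeniusNormSq (fderiv ℝ g y)) →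
        ∃ y₂, θ₀ * L / ν ≤ ‖g y₂‖ := by
  set V₁ := (volume (ball (0 : EuclideanSpace ℝ (Fin 3)) 1)).toReal with hV₁
  have hV₁0 : 0 < V₁ :=
    ENNReal.toReal_pos (measure_ball_pos volume _ one_pos).ne' measure_ball_lt_top.ne
  set q₀ := Real.sqrt (ε / (6 * (R ^ 3 * V₁))) with hq₀
  have hq₀0 : 0 < q₀ := Real.sqrt_pos.2 (by positivity)
  have hq₀2 : q₀ ^ 2 = ε / (6 * (R ^ 3 * V₁)) := Real.sq_sqrt (by positivity)
  have hH1 : 0 < |H| + 1 := by positivity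
  set h₀ := min 1 ((q₀ / (4 * (|H| + 1))) ^ κ⁻¹) with hh₀
  have hh₀0 : 0 < h₀ := lt_min one_pos (Real.rpow_pos_of_pos (by positivity) _)
  have hHh₀ : |H| * h₀ ^ κ ≤ q₀ / 4 := by
    have h1 : h₀ ^ κ ≤ q₀ / (4 * (|H| + 1)) :=
      calc h₀ ^ κ ≤ ((q₀ / (4 * (|H| + 1))) ^ κ⁻¹) ^ κ :=
            Real.rpow_le_rpow hh₀0.le (min_le_right _ _) hκ.le
        _ = q₀ / (4 * (|H| + 1)) := Real.rpow_inv_rpow (by positivity) hκ.ne'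
    have h2 : |H| * (q₀ / (4 * (|H| + 1))) ≤ q₀ / 4 := by
      rw [mul_div_assoc', div_le_div_iff₀ (by positivity) (by positivity)]
      nlinarith [abs_nonneg H]
    exact (mul_le_mul_of_nonneg_left h1 (abs_nonneg H)).trans h2
  refine ⟨3 * h₀ * q₀ / 8, by positivity, ?_⟩
  intro g L ν x hL hν hg hHol hconc
  -- (i) a point of large gradient
  have hρ : 0 < R * ν ^ 2 / L := by positivity
  obtain ⟨y₁, hy₁⟩ := exists_lt_of_le_setLIntegral_ball hρ (by positivity : 0 < ε * L) hconc
  have hq : L ^ 2 / ν ^ 3 * q₀ < ‖fderiv ℝ g y₁‖ := by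
    refine lt_of_pow_lt_pow_left₀ 2 (norm_nonneg _) ?_
    have h3 := frobeniusNormSq_le_three_mul (fderiv ℝ g y₁)
    have hid : (L ^ 2 / ν ^ 3 * q₀) ^ 2 =
        ε * L / (2 * ((R * ν ^ 2 / L) ^ 3 * V₁)) / 3 := by
      rw [mul_pow, hq₀2]
      field_simp
      ring
    rw [hid]
    linarith
  -- (ii)-(iii) the Hölder bound on the ball of radius `h₀ ν²/L` about `y₁`, and the segment
  have hh : 0 < h₀ * ν ^ 2 / L := by positivity
  have hM : ∀ y ∈ closedBall y₁ (h₀ * ν ^ 2 / L),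
      ‖fderiv ℝ g y - fderiv ℝ g y₁‖ ≤ L ^ 2 / ν ^ 3 * (q₀ / 4) := fun y hy => by
    have hdist : ‖y - y₁‖ ≤ h₀ * ν ^ 2 / L := mem_closedBall_iff_norm.1 hy
    have hb0 : 0 ≤ L / ν ^ 2 * ‖y - y₁‖ := by positivity
    have hb : L / ν ^ 2 * ‖y - y₁‖ ≤ h₀ :=
      calc L / ν ^ 2 * ‖y - y₁‖ ≤ L / ν ^ 2 * (h₀ * ν ^ 2 / L) :=
            mul_le_mul_of_nonneg_left hdist (by positivity)
        _ = h₀ := by field_simp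
    calc ‖fderiv ℝ g y - fderiv ℝ g y₁‖
        ≤ H * (L ^ 2 / ν ^ 3) * (L / ν ^ 2 * ‖y - y₁‖) ^ κ := hHol y y₁
      _ ≤ |H| * (L ^ 2 / ν ^ 3) * (L / ν ^ 2 * ‖y - y₁‖) ^ κ :=
          mul_le_mul_of_nonneg_right (mul_le_mul_of_nonneg_right (le_abs_self H) (by positivity))
            (Real.rpow_nonneg hb0 κ)
      _ ≤ |H| * (L ^ 2 / ν ^ 3) * h₀ ^ κ :=
          mul_le_mul_of_nonneg_left (Real.rpow_le_rpow hb0 hb hκ.le) (by positivity)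
      _ = L ^ 2 / ν ^ 3 * (|H| * h₀ ^ κ) := by ring
      _ ≤ L ^ 2 / ν ^ 3 * (q₀ / 4) := mul_le_mul_of_nonneg_left hHh₀ (by positivity)
  obtain ⟨y₂, hy₂⟩ := exists_norm_gt_of_fderiv hg hh hq hM
  refine ⟨y₂, le_of_eq_of_le ?_ hy₂.le⟩
  field_simp
  ring

/-- The base time `t + c_P ν³/(2L²)` zoomed at level `K_P · L` to the rescaled time
`s₀ = −c_P K_P²/2` is the original time `t`. -/
private theorem base_time_identity {ν KP L cP t : ℝ} (hKP : KP ≠ 0) (hL : L ≠ 0) :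
    t + cP * ν ^ 3 / (2 * L ^ 2) + ν ^ 3 / (KP * L) ^ 2 * -(cP * KP ^ 2 / 2) = t := by
  field_simp
  ring

/-- At the velocity scale `ν/(K_P · L)` the velocity `θ₀ L/ν` reads `θ₀/K_P`. -/
private theorem velocity_scale (θ₀ : ℝ) {ν KP L : ℝ} (hν : ν ≠ 0) (hKP : KP ≠ 0) (hL : L ≠ 0) :
    ν / (KP * L) * (θ₀ * L / ν) = θ₀ / KP := by
  field_simp

/-- `a/(2L²) ≤ a/L²` for `a ≥ 0`. -/
private theorem half_sq_le {a L : ℝ} (ha : 0 ≤ a) (hL : 0 < L) :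
    a / (2 * L ^ 2) ≤ a / L ^ 2 :=
  div_le_div_of_nonneg_left ha (by positivity) (by nlinarith)

/-- **stub 2c — `stub_enstrophyConcentrationBranch` (enstrophy concentration at the critical
scale forces velocity concentration).** Hypotheses: the solution (classical on `[0, T)`,
Leray–Hopf, Tao-class on every `[0, T']`, no smooth extension past `T`), the persistence bound
(constants `c_P > 0`, `K_P ≥ 1`), the uniform `C^{1,κ}` bound (constants `C₁, H, κ`),
radii/fractions `R, ε > 0`, and ENSTROPHY CONCENTRATION arbitrarily close to `T`: a time `t`, a
level `L > 0` dominating `E` on `[0, t]` with `t ≥ 3ν³/L²`, and a ball of radius `R ν²/L` carrying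
enstrophy `≥ ε L`. Conclusion: concentrated zooms in the velocity format. Proof: (a) `E` is
unbounded on `[0, T)` (`exists_enstrophy_gt`); (b) ROOM: `E ≤ L'` on `[0, t]` forces
`T − t > c_P ν³/L'²`; (c) `E` is bounded on `[0, T/2]`; (d) probe where `E > max n (bound)`;
(e) the `C^{1,κ}` bound at the concentration time and the pointwise step
`exists_velocity_const` give a point `y₂` with `‖u(t, y₂)‖ ≥ θ₀ L/ν`; (f) level `L n = K_P · L`,
base time `tc = t + c_P ν³/(2L²)`, `s₀ = −c_P K_P²/2`, `θ = θ₀/K_P`, and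
`tc n (L n)² ≥ (T/2) n² → ∞`. -/
theorem stub_enstrophyConcentrationBranch :
    ∀ (ν T : ℝ), 0 < ν → 0 < T →
      ∀ (u : ℝ → EuclideanSpace ℝ (Fin 3) → EuclideanSpace ℝ (Fin 3)) (p : ℝ → EuclideanSpace ℝ (Fin 3) → ℝ),
        IsClassicalNSSolutionOn (Set.Ico 0 T) ν 0 u p → IsLerayHopfOn T ν 0 (u 0) u →
        (∀ T' ∈ Set.Ioo 0 T, ∃ P : ℝ → EuclideanSpace ℝ (Fin 3) → ℝ, IsTaoSolutionOn T' ν (u 0) u P) →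
        ¬ HasSmoothExtensionPast ν 0 u T →
        ∀ cP KP : ℝ, 0 < cP → 1 ≤ KP →
          (∀ t₀ ∈ Set.Ico 0 T, ∀ L : ℝ, 0 < L →
            (∫⁻ x, ENNReal.ofReal (frobeniusNormSq (fderiv ℝ (u t₀) x))) ≤ ENNReal.ofReal L →
            ∀ t ∈ Set.Ico t₀ T, t - t₀ ≤ cP * ν ^ 3 / L ^ 2 →
              (∫⁻ x, ENNReal.ofReal (frobeniusNormSq (fderiv ℝ (u t) x))) ≤ ENNReal.ofReal (KP * L)) →
        ∀ C₁ H κ : ℝ, 0 < κ →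
          (∀ (tc L : ℝ), 0 < tc → tc < T → 0 < L →
            (∀ t ∈ Set.Icc 0 tc,
              ∫⁻ x, ENNReal.ofReal (frobeniusNormSq (fderiv ℝ (u t) x)) ≤ ENNReal.ofReal L) →
            ∀ t ∈ Set.Icc (3 * ν ^ 3 / L ^ 2) tc,
              (∀ x, ‖fderiv ℝ (u t) x‖ ≤ C₁ * L ^ 2 / ν ^ 3) ∧
              (∀ x x', ‖fderiv ℝ (u t) x - fderiv ℝ (u t) x'‖ ≤
                H * (L ^ 2 / ν ^ 3) * (L / ν ^ 2 * ‖x - x'‖) ^ κ)) →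
        ∀ R ε : ℝ, 0 < R → 0 < ε →
          (∀ t' ∈ Set.Ico 0 T, ∃ t ∈ Set.Ico t' T, ∃ x : EuclideanSpace ℝ (Fin 3), ∃ L : ℝ, 0 < L ∧
            (∀ s ∈ Set.Icc 0 t,
              (∫⁻ x, ENNReal.ofReal (frobeniusNormSq (fderiv ℝ (u s) x))) ≤ ENNReal.ofReal L) ∧
            3 * ν ^ 3 / L ^ 2 ≤ t ∧
            ENNReal.ofReal (ε * L) ≤
              ∫⁻ y in Metric.ball x (R * ν ^ 2 / L), ENNReal.ofReal (frobeniusNormSq (fderiv ℝ (u t) y))) →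
        ∃ (tc : ℕ → ℝ) (xc : ℕ → EuclideanSpace ℝ (Fin 3)) (L : ℕ → ℝ) (s₀ θ : ℝ),
          s₀ < 0 ∧ 0 < θ ∧ (∀ n, 0 < tc n ∧ tc n < T) ∧ (∀ n, 0 < L n) ∧
          (∀ n, ∀ t ∈ Set.Icc 0 (tc n),
            ∫⁻ x, ENNReal.ofReal (frobeniusNormSq (fderiv ℝ (u t) x)) ≤ ENNReal.ofReal (L n)) ∧
          Tendsto (fun n => tc n * L n ^ 2) atTop atTop ∧
          (∀ n, θ ≤ ‖(ν / L n) • u (tc n + ν ^ 3 / L n ^ 2 * s₀) (xc n)‖) := by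
  intro ν T hν hT u p hsol hLH hrep hnext cP KP hcP hKP hpers C₁ H κ hκ hC1k R ε hR hε hEC
  have hKP0 : 0 < KP := one_pos.trans_le hKP
  -- (e) the velocity constant of the pointwise step, fixed once and for all
  obtain ⟨θ₀, hθ₀, hvelc⟩ := exists_velocity_const H hR hε hκ
  -- the enstrophy `E s = ∫⁻ |∇u(s)|²`
  obtain ⟨E, hE⟩ : ∃ E : ℝ → ℝ≥0∞,
      ∀ s, E s = ∫⁻ x, ENNReal.ofReal (frobeniusNormSq (fderiv ℝ (u s) x)) := ⟨_, fun _ => rfl⟩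
  simp only [← hE] at hpers hC1k hEC ⊢
  -- (a) unboundedness of `E` on `[0, T)`
  have hunb : ∀ M : ℝ≥0∞, M < ⊤ → ∃ t ∈ Ico 0 T, M < E t := fun M hM =>
    exists_enstrophy_gt hν hT hsol hLH hrep hnext hE hM
  -- (b) ROOM before `T` below a dominated time
  have hroom : ∀ t ∈ Ico 0 T, ∀ L' : ℝ, 0 < L' → (∀ r ∈ Icc 0 t, E r ≤ ENNReal.ofReal L') →
      cP * ν ^ 3 / L' ^ 2 < T - t := by
    intro t ht L' hL' hdomt
    by_contra hle
    push Not at hle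
    obtain ⟨t', ht', hgt⟩ := hunb (ENNReal.ofReal (KP * L')) ENNReal.ofReal_lt_top
    refine absurd ?_ (not_le.2 hgt)
    rcases le_or_gt t' t with h1 | h1
    · exact (hdomt t' ⟨ht'.1, h1⟩).trans
        (ENNReal.ofReal_le_ofReal (le_mul_of_one_le_left hL'.le hKP))
    · exact hpers t ht L' hL' (hdomt t ⟨ht.1, le_rfl⟩) t' ⟨h1.le, ht'.2⟩ (by linarith [ht'.2])
  -- (c) a bound for `E` on `[0, T/2]`
  obtain ⟨P₀, hP₀⟩ := hrep (T / 2) ⟨half_pos hT, half_lt_self hT⟩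
  obtain ⟨C₀, hC₀⟩ := hP₀.sobolev 1
  have hB : ∀ t ∈ Icc 0 (T / 2), E t ≤ 3 * (C₀ : ℝ≥0∞) := fun t ht => by
    rw [hE]
    exact (lintegral_frobeniusNormSq_le_three_mul_iteratedFDeriv_one (u t)).trans
      (mul_le_mul_right (hC₀ t ht) 3)
  have hBtop : 3 * (C₀ : ℝ≥0∞) < ⊤ := ENNReal.mul_lt_top (by simp) ENNReal.coe_lt_top
  -- (d) probing times `tp n > T/2` with `E (tp n) > n`, and the concentrations after them
  have hprobe : ∀ n : ℕ, ∃ t ∈ Ico 0 T, T / 2 < t ∧ (n : ℝ≥0∞) < E t := fun n => by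
    obtain ⟨t, ht, hgt⟩ :=
      hunb (max (n : ℝ≥0∞) (3 * C₀)) (max_lt (ENNReal.natCast_lt_top n) hBtop)
    refine ⟨t, ht, ?_, (le_max_left _ _).trans_lt hgt⟩
    by_contra hle
    push Not at hle
    exact absurd ((hB t ⟨ht.1, hle⟩).trans (le_max_right _ _)) (not_le.2 hgt)
  choose tp htp htp2 htpn using hprobe
  choose t ht x L hL hdomt h3t hconc using fun n => hEC (tp n) (htp n)
  have ht0 : ∀ n, 0 < t n := fun n => by
    have hLn := hL n
    exact lt_of_lt_of_le (by positivity) (h3t n)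
  have htT : ∀ n, t n < T := fun n => (ht n).2
  -- (e) the Hölder bound at the concentration time, and the point of critical velocity
  have hHol : ∀ n, ∀ y y', ‖fderiv ℝ (u (t n)) y - fderiv ℝ (u (t n)) y'‖ ≤
      H * (L n ^ 2 / ν ^ 3) * (L n / ν ^ 2 * ‖y - y'‖) ^ κ := fun n =>
    (hC1k (t n) (L n) (ht0 n) (htT n) (hL n) (hdomt n) (t n) ⟨h3t n, le_rfl⟩).2
  have hdiff : ∀ n, Differentiable ℝ (u (t n)) := fun n =>
    (hsol.contDiff_velocity ⟨(ht0 n).le, htT n⟩).differentiable (by simp)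
  choose y₂ hy₂ using fun n =>
    hvelc (u (t n)) (L n) ν (x n) (hL n) hν (hdiff n) (hHol n) (hconc n)
  -- (f) the base times `tc n = t n + c_P ν³/(2 (L n)²)`
  obtain ⟨tc, htc_def⟩ : ∃ tc : ℕ → ℝ, ∀ n, tc n = t n + cP * ν ^ 3 / (2 * L n ^ 2) :=
    ⟨_, fun _ => rfl⟩
  have hδ : ∀ n, 0 < cP * ν ^ 3 / (2 * L n ^ 2) := fun n => by
    have hLn := hL n
    positivity
  have httc : ∀ n, t n ≤ tc n := fun n => by rw [htc_def]; linarith [hδ n]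
  have htc : ∀ n, 0 < tc n ∧ tc n < T := fun n => by
    have hLn := hL n
    have hr := hroom (t n) ⟨(ht0 n).le, htT n⟩ (L n) hLn (hdomt n)
    have hq : cP * ν ^ 3 / (2 * L n ^ 2) ≤ cP * ν ^ 3 / L n ^ 2 :=
      half_sq_le (by positivity) hLn
    rw [htc_def]
    exact ⟨by linarith [ht0 n, hδ n], by linarith⟩
  -- domination of `E` by `K_P · L n` on `[0, tc n]`
  have hdom : ∀ n, ∀ r ∈ Icc 0 (tc n), E r ≤ ENNReal.ofReal (KP * L n) := by
    intro n r hr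
    have hLn := hL n
    rcases le_or_gt r (t n) with hle | hlt
    · exact (hdomt n r ⟨hr.1, hle⟩).trans
        (ENNReal.ofReal_le_ofReal (le_mul_of_one_le_left hLn.le hKP))
    · refine hpers (t n) ⟨(ht0 n).le, htT n⟩ (L n) hLn (hdomt n (t n) ⟨(ht0 n).le, le_rfl⟩)
        r ⟨hlt.le, hr.2.trans_lt (htc n).2⟩ ?_
      calc r - t n ≤ cP * ν ^ 3 / (2 * L n ^ 2) := by linarith [hr.2, htc_def n]
        _ ≤ cP * ν ^ 3 / L n ^ 2 := half_sq_le (by positivity) hLn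
  -- `tc n · (L n)² → ∞`
  have htend : Tendsto (fun n => tc n * (KP * L n) ^ 2) atTop atTop := by
    have h0 : Tendsto (fun n : ℕ => T / 2 * (n : ℝ) ^ 2) atTop atTop :=
      Tendsto.const_mul_atTop (half_pos hT)
        ((tendsto_pow_atTop two_ne_zero).comp tendsto_natCast_atTop_atTop)
    refine tendsto_atTop_mono (f := fun n : ℕ => T / 2 * (n : ℝ) ^ 2) (fun n => ?_) h0
    have hLn := hL n
    have hnL' : (n : ℝ) < L n :=
      ENNReal.natCast_lt_ofReal.1 ((htpn n).trans_le (hdomt n (tp n) ⟨(htp n).1, (ht n).1⟩))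
    have hnL : (n : ℝ) ≤ KP * L n := hnL'.le.trans (le_mul_of_one_le_left hLn.le hKP)
    have htcn : T / 2 ≤ tc n := ((htp2 n).le.trans (ht n).1).trans (httc n)
    exact mul_le_mul htcn (pow_le_pow_left₀ (Nat.cast_nonneg n) hnL 2) (by positivity)
      ((half_pos hT).le.trans htcn)
  -- the velocity at the rescaled time `s₀` (the original time `t n`) and the centre `y₂ n`
  have hvel : ∀ n, θ₀ / KP ≤
      ‖(ν / (KP * L n)) • u (tc n + ν ^ 3 / (KP * L n) ^ 2 * -(cP * KP ^ 2 / 2)) (y₂ n)‖ :=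
    fun n => by
    have hLn := hL n
    have htime : tc n + ν ^ 3 / (KP * L n) ^ 2 * -(cP * KP ^ 2 / 2) = t n := by
      rw [htc_def]
      exact base_time_identity hKP0.ne' hLn.ne'
    have hcoef : 0 ≤ ν / (KP * L n) := by positivity
    rw [htime, norm_smul, Real.norm_of_nonneg hcoef, ← velocity_scale θ₀ hν.ne' hKP0.ne' hLn.ne']
    exact mul_le_mul_of_nonneg_left (hy₂ n) hcoef
  exact ⟨tc, y₂, fun n => KP * L n, -(cP * KP ^ 2 / 2), θ₀ / KP, neg_lt_zero.2 (by positivity),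
    by positivity, htc, fun n => mul_pos hKP0 (hL n), hdom, htend, hvel⟩

end Summit.NavierStokesRegularity.NavierStokesRegularity.Theorems.RecordZoomAncient.Birth

end
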